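import Summits.KontsevichZagierPeriods.KontsevichZagierPeriods.Theorems.RootDecompRationalCubeDichotomyNashMultiGenP07

/-! # `RootDecompRationalCubeDichotomyNashMultiGenP08` — part 8/16 of the mechanical ≤385-line split of `NashEtaleMultiGen.lean`
(split by the decomp-kz census seat for landing; mathematics unchanged; part 8 continues part 7). -/

open Set MvPolynomial Filter Topology
open Literature.NumberTheory.Transcendental (IsSemialgebraicFunOn)
open Literature.ModelTheory.ExponentialFields (IsSemialgebraic isSemialgebraic_setOf_eval_pos
  isSemialgebraic_setOf_eval_ne_zero)

namespace Summit.KontsevichZagierPeriods.RootDecompRationalCubeDichotomy.Rung29430.MultiGen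
open Summit.KontsevichZagierPeriods.KontsevichZagierPeriods.Theses.RootDecompRationalCubeDichotomy
  (NashEtaleCover NashEtaleLocal PiRationalisation)
open Summit.KontsevichZagierPeriods.RootDecompRationalCubeDichotomy.Rung29430.NashEtaleLocalGlue
  (local_of_simple nashEtaleCover_of_nashEtaleLocal nashEtaleLocal_zero)
open Summit.KontsevichZagierPeriods.RootDecompRationalCubeDichotomy.Rung29430.NashEtaleLocalOne
  (analyticOnNhd_aeval_snoc)
open Summit.KontsevichZagierPeriods.RootDecompRationalCubeDichotomy.RungEtale.Etale
  (piRationalisation_of_nashEtaleCover)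

noncomputable section

namespace Collapse

section Main
open Set Filter Topology
open Literature.NumberTheory.Transcendental
open Literature.ModelTheory.ExponentialFields (IsSemialgebraic isSemialgebraic_setOf_eval_ne_zero
  isSemialgebraic_univ)

set_option maxHeartbeats 800000 in
/-- **`CollapseAt n` holds for every `n`** (Stacks 00UE via Mathlib's
`Algebra.IsEtaleAt.exists_isStandardEtale`, applied to `S' = ℚ[x][y,z]/(F, zJ − 1)` at the point
character of `x₀`; the standard-étale generator is read back as a `ℚ`-Nash function). -/
theorem collapseAt_holds (n : ℕ) : CollapseAt n := by
  intro g x₀ k hM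
  obtain ⟨V₀, u, F, An, Bd, hV₀o, hx₀, husa, huan, hrel, hdet, hAB⟩ := hM
  -- the point vector `pt x = (x, u x)` and the Jacobian function `Jf`
  set pt : (Fin n → ℝ) → Fin (n + k) → ℝ := fun x => Fin.append x (fun j => u j x) with hpt
  set Jf : (Fin n → ℝ) → ℝ := fun x =>
    (Matrix.of fun i j : Fin k => MvPolynomial.aeval (pt x) (pderiv (Fin.natAdd n i) (F j))).det
    with hJf
  have hJpoly : ∀ x, Jf x = MvPolynomial.aeval (pt x) (Jpoly n k F) := fun x => by
    rw [Jpoly, AlgHom.map_det]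
    rfl
  have hJ0x₀ : Jf x₀ ≠ 0 := by
    have hT : (Matrix.of fun i j : Fin k =>
        MvPolynomial.aeval (pt x₀) (pderiv (Fin.natAdd n i) (F j))) =
        (Matrix.of fun i j : Fin k =>
          MvPolynomial.aeval (pt x₀) (pderiv (Fin.natAdd n j) (F i))).transpose := by
      ext i j
      rfl
    rw [hJf]
    simp only
    rw [hT, Matrix.det_transpose]
    exact hdet
  -- analyticity of the coordinates of `pt` and of `Jf` on `V₀`
  have hproj : ∀ (m : Fin n) (x : Fin n → ℝ), AnalyticAt ℝ (fun y : Fin n → ℝ => y m) x :=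
    fun m x => ((ContinuousLinearMap.proj (R := ℝ) (φ := fun _ : Fin n => ℝ) m).analyticAt x).congr
      (Eventually.of_forall fun _ => rfl)
  have hptan : ∀ x ∈ V₀, ∀ l, AnalyticAt ℝ (fun y => pt y l) x := by
    intro x hx l
    induction l using Fin.addCases with
    | left m => exact (hproj m x).congr (Eventually.of_forall fun y => by simp [hpt])
    | right j => exact (huan j x hx).congr (Eventually.of_forall fun y => by simp [hpt])
  have hJan : ∀ x ∈ V₀, AnalyticAt ℝ Jf x := fun x hx => by
    rw [show Jf = fun y => MvPolynomial.aeval (pt y) (Jpoly n k F) from funext hJpoly]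
    exact AnalyticAt.aeval_mvPolynomial (hptan x hx) _
  -- shrink to `V₁ = V₀ ∩ {J ≠ 0}`
  set V₁ : Set (Fin n → ℝ) := V₀ ∩ Jf ⁻¹' {c | c ≠ 0} with hV₁
  have hV₁o : IsOpen V₁ :=
    ContinuousOn.isOpen_inter_preimage
      (fun y hy => (hJan y hy).continuousAt.continuousWithinAt) hV₀o isOpen_ne
  have hx₀V₁ : x₀ ∈ V₁ := ⟨hx₀, hJ0x₀⟩
  have hV₁V₀ : V₁ ⊆ V₀ := fun y hy => hy.1
  have hJ0 : ∀ x ∈ V₁, Jf x ≠ 0 := fun x hx => hx.2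
  -- the evaluation characters along the graph of `u`
  set ev : (Fin n → ℝ) → A n k →ₐ[ℚ] ℝ := fun x =>
    evA x (Fin.snoc (fun j => u j x) (Jf x)⁻¹) with hev
  have hI : ∀ x ∈ V₁, ∀ a ∈ Ideal.span (Set.range (rel F)), ev x a = 0 := fun x hx =>
    evA_vanishes (fun j => hrel x (hV₁V₀ hx) j) (inv_mul_cancel₀ (hJ0 x hx))
  -- étale-ness and the prime `Q` at `x₀`
  haveI : Algebra.FinitePresentation (R n) (S' F) := finitePresentation_S' F
  haveI : Algebra.Etale (R n) (S' F) := etale_S' F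
  let χ₀ : S' F →ₐ[ℚ] ℝ := chi x₀ _ (hI x₀ hx₀V₁)
  let Q : Ideal (S' F) := RingHom.ker χ₀.toRingHom
  haveI hQ : Q.IsPrime := RingHom.ker_isPrime _
  obtain ⟨f, hfQ, hSE⟩ := Algebra.IsEtaleAt.exists_isStandardEtale (R := R n) (S := S' F) Q
  obtain ⟨P⟩ := hSE.nonempty_standardEtalePresentation
  -- polynomial lifts of `f`, of the numerator of `P.x = a / f^e`, and `A, B` through `P`
  obtain ⟨ft, hft⟩ := Ideal.Quotient.mk_surjective f
  obtain ⟨⟨a, fe, hfe⟩, hax⟩ := IsLocalization.surj (Submonoid.powers f) P.x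
  obtain ⟨e, rfl⟩ := (Submonoid.mem_powers_iff _ _).mp hfe
  obtain ⟨at_, hat⟩ := Ideal.Quotient.mk_surjective a
  simp only at hax
  set ι : S' F →+* Localization.Away f :=
    @algebraMap (S' F) (Localization.Away f) inferInstance inferInstance inferInstance with hι
  have hax' : P.x * ι (f ^ e) = ι a := hax
  obtain ⟨pA, nA, hpA⟩ := P.exists_mul_aeval_x_g_pow_eq_aeval_x
    (ι (Ideal.Quotient.mk (Ideal.span (Set.range (rel F))) (rd n k An)))
  obtain ⟨pB, nB, hpB⟩ := P.exists_mul_aeval_x_g_pow_eq_aeval_x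
    (ι (Ideal.Quotient.mk (Ideal.span (Set.range (rel F))) (rd n k Bd)))
  -- the real functions `E p : x ↦ p(x, u x, 1/J x)` and the candidate generator `h`
  set E : A n k → (Fin n → ℝ) → ℝ := fun p x => ev x p with hE
  set h : (Fin n → ℝ) → ℝ := fun x => E at_ x / E ft x ^ e with hh
  -- analyticity on `V₁`
  have hXlast : E (X (Fin.last k)) = fun y => (Jf y)⁻¹ := funext fun y => by
    simp [hE, hev]
  have hXcs : ∀ j : Fin k, E (X (Fin.castSucc j)) = u j := fun j => funext fun y => by
    simp [hE, hev]
  have hXan : ∀ l : Fin (k + 1), ∀ x ∈ V₁, AnalyticAt ℝ (E (X l)) x := by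
    intro l x hx
    refine Fin.lastCases ?_ (fun j => ?_) l
    · rw [hXlast]
      exact (hJan x (hV₁V₀ hx)).fun_inv (hJ0 x hx)
    · rw [hXcs]
      exact huan j x (hV₁V₀ hx)
  have hEan : ∀ p : A n k, ∀ x ∈ V₁, AnalyticAt ℝ (E p) x := by
    intro p
    induction p using MvPolynomial.induction_on with
    | C r =>
      intro x hx
      have hfun : E (C r) = fun y => MvPolynomial.aeval y r := funext fun y => evA_C r
      rw [hfun]
      exact AnalyticAt.aeval_mvPolynomial (fun m => hproj m x) r
    | add p q hp hq =>
      intro x hx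
      have hfun : E (p + q) = fun y => E p y + E q y := funext fun y => map_add _ _ _
      rw [hfun]
      exact (hp x hx).fun_add (hq x hx)
    | mul_X p l hp =>
      intro x hx
      have hfun : E (p * X l) = fun y => E p y * E (X l) y := funext fun y => map_mul _ _ _
      rw [hfun]
      exact (hp x hx).fun_mul (hXan l x hx)
  -- `E ft x₀ ≠ 0` (this is `f ∉ Q`) and the rational box `V`
  have hft0 : E ft x₀ ≠ 0 := by
    intro h0
    apply hfQ
    show χ₀.toRingHom f = 0
    rw [AlgHom.toRingHom_eq_coe, AlgHom.coe_toRingHom, ← hft]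
    exact (chi_mk (hI x₀ hx₀V₁) ft).trans h0
  have hWo : IsOpen (V₁ ∩ E ft ⁻¹' {c | c ≠ 0}) :=
    ContinuousOn.isOpen_inter_preimage
      (fun y hy => (hEan ft y hy).continuousAt.continuousWithinAt) hV₁o isOpen_ne
  obtain ⟨a', b', hx₀V, hVW⟩ := exists_ratBox_subset hWo (x₀ := x₀) ⟨hx₀V₁, hft0⟩
  set V : Set (Fin n → ℝ) := ratBox a' b' with hV
  have hVV₁ : V ⊆ V₁ := fun y hy => (hVW hy).1
  have hVV₀ : V ⊆ V₀ := hVV₁.trans hV₁V₀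
  have hVft : ∀ y ∈ V, E ft y ≠ 0 := fun y hy => (hVW hy).2
  have hVo : IsOpen V := isOpen_ratBox a' b'
  have hVsa : IsSemialgebraic ℚ V := isSemialgebraic_ratBox a' b'
  -- semialgebraicity on `V`
  have hcoord : ∀ m : Fin n, IsSemialgebraicFunOn ℚ V (fun y => y m) := fun m =>
    (isSemialgebraicFunOn_aeval hVsa (X m : MvPolynomial (Fin n) ℚ)).congr fun y _ => by simp
  have huV : ∀ j, IsSemialgebraicFunOn ℚ V (u j) := fun j => (husa j).mono hVV₀ hVsa
  have hΦ : IsSemialgebraicMapOn ℚ V pt := by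
    refine IsSemialgebraicMapOn.of_forall hVsa fun l => ?_
    induction l using Fin.addCases with
    | left m => exact (hcoord m).congr fun y _ => by simp [hpt]
    | right j => exact (huV j).congr fun y _ => by simp [hpt]
  have hJsa : IsSemialgebraicFunOn ℚ V Jf := by
    have hq := isSemialgebraicFunOn_aeval (k := ℚ)
      (isSemialgebraic_univ (k := ℚ) (R := ℝ) (ι := Fin (n + k))) (Jpoly n k F)
    have hc := IsSemialgebraicFunOn.comp_isSemialgebraicMapOn_holds hq hΦ (fun _ _ => mem_univ _)
    exact hc.congr fun y _ => by
      simp only [Function.comp_apply]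
      exact (hJpoly y).symm
  have hXsa : ∀ l : Fin (k + 1), IsSemialgebraicFunOn ℚ V (E (X l)) := by
    intro l
    refine Fin.lastCases ?_ (fun j => ?_) l
    · rw [hXlast]
      have h1 : IsSemialgebraicFunOn ℚ V (fun _ => (1 : ℝ)) :=
        (isSemialgebraicFunOn_aeval hVsa (1 : MvPolynomial (Fin n) ℚ)).congr fun y _ => by simp
      refine (isSemialgebraicFunOn_div_pow hVsa h1 hJsa (fun y hy => hJ0 y (hVV₁ hy)) 1).congr
        fun y _ => ?_
      simp
    · rw [hXcs]
      exact huV j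
  have hEsa : ∀ p : A n k, IsSemialgebraicFunOn ℚ V (E p) := by
    intro p
    induction p using MvPolynomial.induction_on with
    | C r =>
      exact (isSemialgebraicFunOn_aeval hVsa r).congr fun y _ => (evA_C (x := y)
        (v := Fin.snoc (fun j => u j y) (Jf y)⁻¹) r).symm
    | add p q hp hq =>
      exact (IsSemialgebraicFunOn.add_holds hp hq).congr fun y _ => by simp [hE]
    | mul_X p l hp =>
      exact (IsSemialgebraicFunOn.mul_holds hp (hXsa l)).congr fun y _ => by simp [hE]
  -- the one-generator data
  refine ⟨V, h, fromPoly n P.f, fromPoly n (pA * P.g ^ nB), fromPoly n (pB * P.g ^ nA), hVo, hx₀V,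
    ?_, ?_, fun y hy => ?_⟩
  · exact (isSemialgebraicFunOn_div_pow hVsa (hEsa at_) (hEsa ft) hVft e).congr fun y _ => by
      simp [hh]
  · intro y hy
    exact ((hEan at_ y (hVV₁ hy)).fun_div ((hEan ft y (hVV₁ hy)).fun_pow e)
      (pow_ne_zero e (hVft y hy))).congr (Eventually.of_forall fun z => by simp [hh])
  · have hyV₁ := hVV₁ hy
    -- the point character at `y` and its extension `ψ` to `S'_f`
    set χ : S' F →ₐ[ℚ] ℝ := chi y _ (hI y hyV₁) with hχ
    have hχmk : ∀ p : A n k, χ (Ideal.Quotient.mk _ p) = E p y := fun p => by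
      rw [hχ, chi_mk]
    have hunit : IsUnit (χ.toRingHom f) := by
      rw [AlgHom.toRingHom_eq_coe, AlgHom.coe_toRingHom, ← hft, hχmk]
      exact isUnit_iff_ne_zero.mpr (hVft y hy)
    set ψ : Localization.Away f →+* ℝ := IsLocalization.Away.lift f hunit with hψ
    have hψalg : ∀ s : S' F, ψ (ι s) = χ s := fun s => IsLocalization.Away.lift_eq f hunit s
    have hψR : ∀ r : R n, ψ (algebraMap (R n) (Localization.Away f) r) = MvPolynomial.aeval y r :=
      fun r => by
      rw [IsScalarTower.algebraMap_apply (R n) (S' F) (Localization.Away f)]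
      exact (hψalg _).trans (by rw [hχ, chi_algebraMap])
    have hχf : χ f = E ft y := by
      have h1 := hχmk ft
      rwa [hft] at h1
    have hχa : χ a = E at_ y := by
      have h1 := hχmk at_
      rwa [hat] at h1
    have hψx : ψ P.x = h y := by
      have h1 := congrArg ψ hax'
      rw [map_mul, hψalg, hψalg, map_pow, hχf, hχa] at h1
      rw [hh]
      exact eq_div_of_mul_eq (pow_ne_zero e (hVft y hy)) h1
    have hcompR : ψ.comp (algebraMap (R n) (Localization.Away f)) =
        ((MvPolynomial.aeval y : R n →ₐ[ℚ] ℝ) : R n →+* ℝ) :=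
      RingHom.ext fun r => by simpa using hψR r
    have hval : ∀ p : Polynomial (R n),
        MvPolynomial.aeval (Fin.snoc y (h y) : Fin (n + 1) → ℝ) (fromPoly n p) =
          ψ (Polynomial.aeval P.x p) := by
      intro p
      rw [aeval_snoc_fromPoly, evP_apply, Polynomial.aeval_def, Polynomial.hom_eval₂, hψx, hcompR]
    have hγ : ψ (Polynomial.aeval P.x P.g) ≠ 0 := ((P.hasMap.2).map ψ).ne_zero
    have hf' : ψ (Polynomial.aeval P.x (Polynomial.derivative P.f)) ≠ 0 :=
      ((P.hasMap.isUnit_derivative_f).map ψ).ne_zero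
    have hEA : E (rd n k An) y = MvPolynomial.aeval (pt y) An := by
      simp only [hE, hev, evA_rd, Fin.snoc_castSucc]
      rfl
    have hEB : E (rd n k Bd) y = MvPolynomial.aeval (pt y) Bd := by
      simp only [hE, hev, evA_rd, Fin.snoc_castSucc]
      rfl
    have hAψ := congrArg ψ hpA
    have hBψ := congrArg ψ hpB
    rw [map_mul, map_pow, hψalg, hχmk, hEA] at hAψ
    rw [map_mul, map_pow, hψalg, hχmk, hEB] at hBψ
    obtain ⟨hB0, hg⟩ := hAB y (hVV₀ hy)
    have hB0' : MvPolynomial.aeval (pt y) Bd ≠ 0 := hB0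
    have hg' : g y = MvPolynomial.aeval (pt y) An / MvPolynomial.aeval (pt y) Bd := hg
    clear hB0 hg
    refine ⟨?_, ?_, ?_, ?_⟩
    · rw [hval, P.hasMap.1, map_zero]
    · rw [pderiv_last_fromPoly, hval]
      exact hf'
    · rw [hval, map_mul, map_pow, map_mul, map_pow, ← hBψ]
      exact mul_ne_zero (mul_ne_zero hB0' (pow_ne_zero _ hγ)) (pow_ne_zero _ hγ)
    · rw [hval, hval, map_mul, map_pow, map_mul, map_pow, map_mul, map_pow, map_mul, map_pow,
        ← hAψ, ← hBψ, hg']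
      field_simp

end Main

end Collapse

/-- **Piece C, PROVED**: `CollapseAt n` for every `n`. -/
theorem collapseAt_holds (n : ℕ) : CollapseAt n := Collapse.collapseAt_holds n

/-! ## §5  Compositions -/

/-- **LEVEL 2 composition.** `MultiGenAt n ⟸ (defect 0: proved) ∧ MultiGenDefectOneAt n ∧ MultiGenSpecialAt n`. -/
theorem multiGenAt_of_strata {n : ℕ} (h1 : MultiGenDefectOneAt n) (h2 : MultiGenSpecialAt n) :
    MultiGenAt n := by
  intro g U hU hKU hsa han x₀ hx₀
  by_cases hind : AlgebraicIndependent ℚ x₀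
  · exact ⟨1, multiGenData_of_algebraicIndependent hU hsa han (hKU hx₀) hind⟩
  by_cases hd : DefectLeOne x₀
  · exact h1 g U hU hKU hsa han x₀ hx₀ hind hd
  · exact h2 g U hU hKU hsa han x₀ hx₀ hd

/-- The node in dimension `n` from the three pieces `C`, `M₁`, `M₂`. -/
theorem nashEtaleLocalAt_of_pieces {n : ℕ} (hC : CollapseAt n) (h1 : MultiGenDefectOneAt n)
    (h2 : MultiGenSpecialAt n) : NashEtaleLocalAt n :=
  nashEtaleLocalAt_of_collapse_of_multiGen hC (multiGenAt_of_strata h1 h2)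

/-- **Item 31659 `NashEtaleLocal` from the pieces**: dimension `0` is landed, dimension `1` is
g7's `nashEtaleLocalAt_of_le_one` (HOME, critic-cleared; hypothesis here), dimensions `≥ 2`
from `CollapseAt`, `MultiGenDefectOneAt`, `MultiGenSpecialAt`. -/
theorem nashEtaleLocal_of_pieces (h₁ : NashEtaleLocalAt 1)
    (hC : ∀ n, 2 ≤ n → CollapseAt n) (hM₁ : ∀ n, 2 ≤ n → MultiGenDefectOneAt n)
    (hM₂ : ∀ n, 2 ≤ n → MultiGenSpecialAt n) : NashEtaleLocal := by
  rw [nashEtaleLocal_iff]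
  intro n
  rcases Nat.lt_or_ge n 2 with hn | hn
  · interval_cases n
    · exact nashEtaleLocalAt_zero
    · exact h₁
  · exact nashEtaleLocalAt_of_pieces (hC n hn) (hM₁ n hn) (hM₂ n hn)

/-- … hence item 29430 `NashEtaleCover` (landed edge `nashEtaleCover_of_nashEtaleLocal`). -/
theorem nashEtaleCover_of_pieces (h₁ : NashEtaleLocalAt 1)
    (hC : ∀ n, 2 ≤ n → CollapseAt n) (hM₁ : ∀ n, 2 ≤ n → MultiGenDefectOneAt n)
    (hM₂ : ∀ n, 2 ≤ n → MultiGenSpecialAt n) : NashEtaleCover :=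
  nashEtaleCover_of_nashEtaleLocal (nashEtaleLocal_of_pieces h₁ hC hM₁ hM₂)

/-- … hence crux 24903 `PiRationalisation` (landed edge `piRationalisation_of_nashEtaleCover`). -/
theorem piRationalisation_of_pieces (h₁ : NashEtaleLocalAt 1)
    (hC : ∀ n, 2 ≤ n → CollapseAt n) (hM₁ : ∀ n, 2 ≤ n → MultiGenDefectOneAt n)
    (hM₂ : ∀ n, 2 ≤ n → MultiGenSpecialAt n) : PiRationalisation :=
  piRationalisation_of_nashEtaleCover (nashEtaleCover_of_pieces h₁ hC hM₁ hM₂)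

/-- Variant keeping LEVEL 1 only (pieces `C` and `M`). -/
theorem nashEtaleLocal_of_collapse_of_multiGen (h₁ : NashEtaleLocalAt 1)
    (hC : ∀ n, 2 ≤ n → CollapseAt n) (hM : ∀ n, 2 ≤ n → MultiGenAt n) : NashEtaleLocal :=
  nashEtaleLocal_of_pieces h₁ hC (fun n hn => multiGenDefectOneAt_of_multiGenAt (hM n hn))
    (fun n hn => multiGenSpecialAt_of_multiGenAt (hM n hn))

/-! ### §5b  With piece C PROVED (§4c): the node from the strata pieces alone

In dimension `1` the special stratum is empty, so `NashEtaleLocalAt 1 ⟸ MultiGenDefectOneAt 1`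
and the whole item needs no separate `n = 1` input any more. -/

/-- LEVEL 1 is an EQUIVALENCE: the node in dimension `n` ⟺ its many-generator form. -/
theorem nashEtaleLocalAt_iff_multiGenAt {n : ℕ} : NashEtaleLocalAt n ↔ MultiGenAt n :=
  ⟨multiGenAt_of_nashEtaleLocalAt, nashEtaleLocalAt_of_collapse_of_multiGen (collapseAt_holds n)⟩

/-- In dimension `1` every point has defect `≤ 1`. -/
theorem defectLeOne_of_one (x₀ : Fin 1 → ℝ) : DefectLeOne x₀ := by
  haveI : IsEmpty {j : Fin 1 // j ≠ (0 : Fin 1)} := ⟨fun j => j.2 (Subsingleton.elim _ _)⟩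
  exact ⟨0, algebraicIndependent_empty_type⟩

/-- … so the special piece is vacuous in dimension `1`. -/
theorem multiGenSpecialAt_one : MultiGenSpecialAt 1 :=
  fun _ _ _ _ _ _ x₀ _ hnd => (hnd (defectLeOne_of_one x₀)).elim

/-- The node in dimension `n` from the two strata pieces. -/
theorem nashEtaleLocalAt_of_strata {n : ℕ} (h1 : MultiGenDefectOneAt n) (h2 : MultiGenSpecialAt n) :
    NashEtaleLocalAt n :=
  nashEtaleLocalAt_of_pieces (collapseAt_holds n) h1 h2

/-- Dimension `1` from the defect-one piece alone (its content: the algebraic points of `[0,1]`). -/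
theorem nashEtaleLocalAt_one_of_defectOne (h1 : MultiGenDefectOneAt 1) : NashEtaleLocalAt 1 :=
  nashEtaleLocalAt_of_strata h1 multiGenSpecialAt_one

/-- **Item 31659 `NashEtaleLocal` from the strata pieces alone** (`C` and defect `0` proved). -/
theorem nashEtaleLocal_of_strata (hM₁ : ∀ n, 1 ≤ n → MultiGenDefectOneAt n)
    (hM₂ : ∀ n, 2 ≤ n → MultiGenSpecialAt n) : NashEtaleLocal :=
  nashEtaleLocal_of_pieces (nashEtaleLocalAt_one_of_defectOne (hM₁ 1 le_rfl))
    (fun n _ => collapseAt_holds n) (fun n hn => hM₁ n (by omega)) hM₂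

/-- … hence item 29430 `NashEtaleCover`. -/
theorem nashEtaleCover_of_strata (hM₁ : ∀ n, 1 ≤ n → MultiGenDefectOneAt n)
    (hM₂ : ∀ n, 2 ≤ n → MultiGenSpecialAt n) : NashEtaleCover :=
  nashEtaleCover_of_nashEtaleLocal (nashEtaleLocal_of_strata hM₁ hM₂)

/-- … hence crux 24903 `PiRationalisation`. -/
theorem piRationalisation_of_strata (hM₁ : ∀ n, 1 ≤ n → MultiGenDefectOneAt n)
    (hM₂ : ∀ n, 2 ≤ n → MultiGenSpecialAt n) : PiRationalisation :=
  piRationalisation_of_nashEtaleCover (nashEtaleCover_of_strata hM₁ hM₂)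

/-- Item 31659 from the many-generator form in every positive dimension. -/
theorem nashEtaleLocal_of_multiGen (hM : ∀ n, 1 ≤ n → MultiGenAt n) : NashEtaleLocal := by
  rw [nashEtaleLocal_iff]
  intro n
  rcases Nat.eq_zero_or_pos n with rfl | hn
  · exact nashEtaleLocalAt_zero
  · exact nashEtaleLocalAt_iff_multiGenAt.mpr (hM n hn)

/-- Item 31659 from the typed THEOREM-IN-PRINT `EtaleAlgebraicPowerSeries` (Nagata 44.1 +
Swan 2.5) and the glue claim `SpecialStrataViaPowerSeries` (§4b). -/
theorem nashEtaleLocal_of_fact (hF : ∀ d, EtaleAlgebraicPowerSeries d)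
    (hG : SpecialStrataViaPowerSeries) : NashEtaleLocal :=
  nashEtaleLocal_of_strata (fun n hn => (hG hF n hn).1) (fun n hn => (hG hF n (by omega)).2)

/-- … and crux 24903 from the same two inputs. -/
theorem piRationalisation_of_fact (hF : ∀ d, EtaleAlgebraicPowerSeries d)
    (hG : SpecialStrataViaPowerSeries) : PiRationalisation :=
  piRationalisation_of_nashEtaleCover
    (nashEtaleCover_of_nashEtaleLocal (nashEtaleLocal_of_fact hF hG))

/-! ## §5c  Point-data form of the special strata (v3)

With §4e/§4f the generators `u` never have to be produced by hand: the special strata reduce to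
ÉTALE POINT DATA plus the IDENTIFICATION of `g` along the solution — `SpecialPointData n` — and
the only non-formalised input left is that identification (the formal half of the glue, fed by the
THEOREM-IN-PRINT `EtaleAlgebraicPowerSeries`). -/

end
end Summit.KontsevichZagierPeriods.RootDecompRationalCubeDichotomy.Rung29430.MultiGen
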